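import Literature.NumberTheory.PAdicHodge.DualExpEllipticTower
import HarnessLib

/-!
# (S5b) / hT₂ REDUCED: the trace-dual range of `exp*_ω` from a reciprocity law and Tate duality for a `ℤ_p`-valued
# Kummer pairing — the final assembly of the hT₂ programme, with the two deep inputs DISPLAYED

Topic `Literature/NumberTheory/PAdicHodge`; namespace `Literature.NumberTheory.PAdicHodge`. Proof file (theorems only: no
definition, no named fact, no instance, no `sorry`) next to `DualExpElliptic.lean` / `DualExpEllipticTower.lean`, whose
cite-only facts (S5b) `exists_smul_range_expStarCoord_iff_trace_log` and (S5b-tower)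
`exists_smul_range_expStarCoord_tower_iff_trace_log` (Kato II Thm. 1.4.1 (3)–(4) + BK90 Prop. 3.8 / Ex. 3.11) it REDUCES to
their printed ingredients, for ANY `ℤ_p`-valued pairing `B(η, P)` of continuous crossed homomorphisms of `T_pW|_{Γ_F}` with
points `P ∈ E(F)` (the intended `B` is the local Tate pairing with the Kummer image,
`Literature.NumberTheory.EllipticCurves.tatePairingPoint` of `LocalTatePairingPoints.lean`, `⟨[η], κ P⟩ = inv_F([η] ∪ κ P)`):

* [REC] **reciprocity** (Kato II Thm. 1.4.1 (4) with Lemma 1.4.3–1.4.5; BK90 Ex. 3.10.1/(3.11.1); Delbourgo's trace formula):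
  `B(η, P) = Tr_{F/ℚ_p}(c · exp*_d(η) · log_ω P)` in `ℚ_p`, for one `c ∈ Fˣ` (the position of `d.ω` against `ω`);
* [TD] **Tate duality with saturation of the Kummer image** (NSW (7.2.6), BK90 Prop. 3.8 for `T_pE`): every additive
  `φ : E(F) → ℤ_p` is `B(η, ·)` for some `η`;
* [N] **non-degeneracy** `(∀ P, Tr(b · log_ω P) = 0) → b = 0` (the logarithm spans `F`; in the tree for unramified fields,
  in progress in general: `DualExpEllipticLogTraceNondegenerate`) and [ADD] additivity of `log_ω` on `E(F)` (tree:
  `FormalGroupChart.padicLogPointFiniteExt_add` under its level hypotheses).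

Results:
* `norm_trace_mul_le_one_of_reciprocity` — [REC] alone gives the INTEGRALITY direction
  `(∃ η, exp*_{c⁻¹•d}(η) = a) → ∀ P, ‖Tr(a · log_ω P)‖ ≤ 1` (the direction the K★ chain of crux 22226 consumes);
* ★ `range_expStarCoord_smul_iff_of_reciprocity` — [REC] ∧ [TD] ∧ [N] ∧ [ADD] give the (S5b) clause VERBATIM for the
  rescaling `e = c⁻¹`: `(∃ η, exp*_{e•d}(η) = a) ↔ ∀ P, ‖Tr_{F/ℚ_p}(a · log_ω P)‖ ≤ 1`;
* ★ `exists_smul_range_tower_of_reciprocity` — the (S5b-tower) conclusion VERBATIM from the same inputs at the two levels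
  `F₀`, `F` with ONE constant `c ∈ F₀ˣ` (the same differential `ω` at both levels).

So the cite fact hT₂ of the K★ line (`Summits/…/Cruxes/StarredOptimalManinUnitFiveSeven/Lines/kato_lever.lean`, stub
`stub_expStarTower`) is EXACTLY [REC] (XL: the explicit reciprocity law for `V_pE`) + [TD] (the unimodularity of the tree's
`ℤ_p`-valued local Tate pairing, bricks K2 (d)–(e)) + [N]/[ADD] (bricks K4); nothing else. BSD is not proved by any of this.

## References
* K. Kato, LNM 1553 (1993), Ch. II Thm. 1.4.1 (3)–(4), Lemma 1.4.3–1.4.5, §1.2.4. [Kato1993LNM1553]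
* S. Bloch, K. Kato (1990), Prop. 3.8, Ex. 3.10.1, Example 3.11. [BlochKato1990]
* D. Delbourgo (2008), §2.2 (trace formula for `exp*`). [Delbourgo2008]
* J. Neukirch, A. Schmidt, K. Wingberg (2008), (7.2.6). [NeukirchSchmidtWingberg2008]
-/

noncomputable section

open scoped Classical NNReal
open Field ValuativeRel
open Literature.NumberTheory.GaloisRepresentations
open Literature.NumberTheory.GaloisRepresentations.IsNonarchimedeanLocalField
open Literature.NumberTheory.EllipticCurves WeierstrassCurve

namespace Literature.NumberTheory.PAdicHodge

section OneLevel

variable {K₀ : Type} [Field K₀] (W : WeierstrassCurve K₀) [W.IsElliptic]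
  {F : Type} [Field F] [Algebra K₀ F] [ValuativeRel F] [TopologicalSpace F]
  [IsNonarchimedeanLocalField F] [CharZero F] {p : ℕ} [Fact p.Prime]
  [Fact (¬ IsUnit (p : integerC F))] [IsAdicComplete (Ideal.span {(p : integerC F)}) (integerC F)]
  (hp : valuation F p < 1) [Algebra ℚ_[p] F]
  (w : Valuation F ℝ≥0) [(W.baseChange F).IsIntegral w.integer]
  (d : (bdRPeriodRingData (F := F) (p := p) hp).FilZeroLine (restrictedRationalTateRep W F p))
  (B : contOneCocycles (restrictedTateRep W F p).toTopRep → (W.baseChange F).toAffine.Point → ℤ_[p])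
  (c : F) (hc : c ≠ 0)

/-- **Scale law for the scalar dual exponential of an elliptic curve**: `exp*_{e•d}(η) = e⁻¹ · exp*_d(η)`
(`FilZeroLine.dualExpCoord_smul` read through `expStarCoord`). [cite: Kato1993LNM1553, Ch. II §1.2.4 and Ex. 1.3.5] -/
theorem expStarCoord_smul {e : F} (he : e ≠ 0) (η : contOneCocycles (restrictedTateRep W F p).toTopRep) :
    expStarCoord W hp (d.smul e he) η = e⁻¹ * expStarCoord W hp d η := by
  unfold expStarCoord
  rw [PeriodRingData.FilZeroLine.smul_ω]
  exact PeriodRingData.FilZeroLine.dualExpCoord_smul d he _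

variable (hrec : ∀ (η : contOneCocycles (restrictedTateRep W F p).toTopRep) (P : (W.baseChange F).toAffine.Point),
    ((B η P : ℤ_[p]) : ℚ_[p]) =
      Algebra.trace ℚ_[p] F (c * expStarCoord W hp d η * FormalGroupChart.padicLogPointFiniteExt w (W.baseChange F) p P))

include hrec in
/-- **The INTEGRALITY direction from reciprocity alone**: if `a = exp*_{c⁻¹•d}(η) = c · exp*_d(η)` then
`Tr_{F/ℚ_p}(a · log_ω P) = B(η, P) ∈ ℤ_p` for every `P ∈ E(F)` — Kato II Thm. 1.4.1 (4): the pairing of an integral class with a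
Kummer class is a `p`-adic integer. [cite: Kato1993LNM1553, Ch. II Thm. 1.4.1 (4)] [cite: BlochKato1990, Prop. 3.8 (p. 354)] -/
theorem norm_trace_mul_le_one_of_reciprocity (a : F)
    (ha : ∃ η : contOneCocycles (restrictedTateRep W F p).toTopRep, expStarCoord W hp (d.smul c⁻¹ (inv_ne_zero hc)) η = a)
    (P : (W.baseChange F).toAffine.Point) :
    ‖Algebra.trace ℚ_[p] F (a * FormalGroupChart.padicLogPointFiniteExt w (W.baseChange F) p P)‖ ≤ 1 := by
  obtain ⟨η, rfl⟩ := ha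
  rw [expStarCoord_smul, inv_inv, ← hrec η P]
  exact PadicInt.norm_le_one _

variable
  (htd : ∀ φ : (W.baseChange F).toAffine.Point →+ ℤ_[p],
    ∃ η : contOneCocycles (restrictedTateRep W F p).toTopRep, ∀ P, B η P = φ P)
  (hN : ∀ b : F, (∀ P : (W.baseChange F).toAffine.Point,
    Algebra.trace ℚ_[p] F (b * FormalGroupChart.padicLogPointFiniteExt w (W.baseChange F) p P) = 0) → b = 0)
  (hadd : ∀ P Q : (W.baseChange F).toAffine.Point,
    FormalGroupChart.padicLogPointFiniteExt w (W.baseChange F) p (P + Q) =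
      FormalGroupChart.padicLogPointFiniteExt w (W.baseChange F) p P +
        FormalGroupChart.padicLogPointFiniteExt w (W.baseChange F) p Q)

include hrec htd hN hadd in
/-- ★ **(S5b) from [REC] ∧ [TD] ∧ [N] ∧ [ADD]**: for the rescaling `e = c⁻¹` of the generator `d`,
`(∃ η, exp*_{e•d}(η) = a) ↔ ∀ P ∈ E(F), ‖Tr_{F/ℚ_p}(a · log_ω P)‖ ≤ 1`. `→` is `norm_trace_mul_le_one_of_reciprocity`; `←`:
`P ↦ Tr(a · log_ω P)` is an additive map `E(F) → ℤ_p` ([ADD]), hence `= B(η, ·)` for some `η` ([TD]), hence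
`Tr((c · exp*_d(η) − a) · log_ω P) = 0` for all `P` ([REC]) and `a = c · exp*_d(η) = exp*_{c⁻¹•d}(η)` ([N]).
[cite: Kato1993LNM1553, Ch. II Thm. 1.4.1 (3)–(4)] [cite: BlochKato1990, Prop. 3.8 (p. 354), Example 3.11 (p. 361)] -/
theorem range_expStarCoord_smul_iff_of_reciprocity (a : F) :
    (∃ η : contOneCocycles (restrictedTateRep W F p).toTopRep, expStarCoord W hp (d.smul c⁻¹ (inv_ne_zero hc)) η = a) ↔
      ∀ P : (W.baseChange F).toAffine.Point,
        ‖Algebra.trace ℚ_[p] F (a * FormalGroupChart.padicLogPointFiniteExt w (W.baseChange F) p P)‖ ≤ 1 := by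
  refine ⟨norm_trace_mul_le_one_of_reciprocity W hp w d B c hc hrec a, fun ha => ?_⟩
  -- the additive map `φ_a : E(F) → ℤ_p`, `P ↦ Tr(a · log_ω P)`
  let φ : (W.baseChange F).toAffine.Point →+ ℤ_[p] :=
    { toFun := fun P => ⟨Algebra.trace ℚ_[p] F (a * FormalGroupChart.padicLogPointFiniteExt w (W.baseChange F) p P), ha P⟩
      map_zero' := by
        apply Subtype.ext
        change Algebra.trace ℚ_[p] F (a * FormalGroupChart.padicLogPointFiniteExt w (W.baseChange F) p 0) = 0
        have h0 : FormalGroupChart.padicLogPointFiniteExt w (W.baseChange F) p 0 = 0 := by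
          have h := hadd 0 0
          rw [add_zero] at h
          exact left_eq_add.mp h
        rw [h0, mul_zero, map_zero]
      map_add' := fun P Q => by
        apply Subtype.ext
        change Algebra.trace ℚ_[p] F (a * FormalGroupChart.padicLogPointFiniteExt w (W.baseChange F) p (P + Q)) =
          Algebra.trace ℚ_[p] F (a * FormalGroupChart.padicLogPointFiniteExt w (W.baseChange F) p P) +
            Algebra.trace ℚ_[p] F (a * FormalGroupChart.padicLogPointFiniteExt w (W.baseChange F) p Q)
        rw [hadd, mul_add, map_add] }
  obtain ⟨η, hη⟩ := htd φ
  refine ⟨η, ?_⟩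
  -- `c · exp*_d(η) = a` by non-degeneracy
  have hb : c * expStarCoord W hp d η - a = 0 := hN _ fun P => by
    rw [sub_mul, map_sub, ← hrec η P, hη P, sub_eq_zero]
    rfl
  rw [expStarCoord_smul, inv_inv]
  exact sub_eq_zero.mp hb

end OneLevel

/-! ### The tower: two levels, one constant -/

section Tower

variable {K₀ : Type} [Field K₀] (W : WeierstrassCurve K₀) [W.IsElliptic]
  -- the lower field `F₀ ⊇ K₀`
  {F₀ : Type} [Field F₀] [Algebra K₀ F₀] [ValuativeRel F₀] [TopologicalSpace F₀]
  [IsNonarchimedeanLocalField F₀] [CharZero F₀] {p : ℕ} [Fact p.Prime]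
  [Fact (¬ IsUnit (p : integerC F₀))] [IsAdicComplete (Ideal.span {(p : integerC F₀)}) (integerC F₀)]
  (hp₀ : valuation F₀ p < 1) [Algebra ℚ_[p] F₀]
  (w₀ : Valuation F₀ ℝ≥0) [(W.baseChange F₀).IsIntegral w₀.integer]
  -- the upper field `F ⊇ F₀`
  {F : Type} [Field F] [Algebra K₀ F] [Algebra F₀ F] [ValuativeRel F]
  [TopologicalSpace F] [IsNonarchimedeanLocalField F] [CharZero F]
  [Fact (¬ IsUnit (p : integerC F))] [IsAdicComplete (Ideal.span {(p : integerC F)}) (integerC F)]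
  (hp : valuation F p < 1) [Algebra ℚ_[p] F]
  (w : Valuation F ℝ≥0) [(W.baseChange F).IsIntegral w.integer]
  (d₀ : (bdRPeriodRingData (F := F₀) (p := p) hp₀).FilZeroLine (restrictedRationalTateRep W F₀ p))
  (d : (bdRPeriodRingData (F := F) (p := p) hp).FilZeroLine
    ((restrictedRationalTateRep W F₀ p).restrict (absGaloisRestrict F₀ F)))
  -- the pairings at the two levels
  (B₀ : contOneCocycles (restrictedTateRep W F₀ p).toTopRep → (W.baseChange F₀).toAffine.Point → ℤ_[p])
  (B : contOneCocycles ((restrictedTateRep W F₀ p).restrict (absGaloisRestrict F₀ F)).toTopRep →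
    (W.baseChange F).toAffine.Point → ℤ_[p])
  (c : F₀) (hc : c ≠ 0)

omit [ValuativeRel F₀] [TopologicalSpace F₀] [IsNonarchimedeanLocalField F₀] [CharZero F₀]
  [Fact (¬ IsUnit (p : integerC F₀))] [IsAdicComplete (Ideal.span {(p : integerC F₀)}) (integerC F₀)] [Algebra ℚ_[p] F₀]
  [Algebra K₀ F] in
/-- Scale law for the tower coordinate: `exp*_{e•d}(η) = e⁻¹ · exp*_d(η)`. [cite: Kato1993LNM1553, Ch. II §1.2.4 and Ex. 1.3.5] -/
theorem expStarCoordTower_smul {e : F} (he : e ≠ 0)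
    (η : contOneCocycles ((restrictedTateRep W F₀ p).restrict (absGaloisRestrict F₀ F)).toTopRep) :
    expStarCoordTower W hp (d.smul e he) η = e⁻¹ * expStarCoordTower W hp d η := by
  unfold expStarCoordTower
  rw [PeriodRingData.FilZeroLine.smul_ω]
  exact PeriodRingData.FilZeroLine.dualExpCoord_smul d he _

variable
  (hrec₀ : ∀ (η₀ : contOneCocycles (restrictedTateRep W F₀ p).toTopRep) (P : (W.baseChange F₀).toAffine.Point),
    ((B₀ η₀ P : ℤ_[p]) : ℚ_[p]) =
      Algebra.trace ℚ_[p] F₀ (c * expStarCoord W hp₀ d₀ η₀ * FormalGroupChart.padicLogPointFiniteExt w₀ (W.baseChange F₀) p P))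
  (hrec : ∀ (η : contOneCocycles ((restrictedTateRep W F₀ p).restrict (absGaloisRestrict F₀ F)).toTopRep)
      (P : (W.baseChange F).toAffine.Point),
    ((B η P : ℤ_[p]) : ℚ_[p]) =
      Algebra.trace ℚ_[p] F (algebraMap F₀ F c * expStarCoordTower W hp d η *
        FormalGroupChart.padicLogPointFiniteExt w (W.baseChange F) p P))
  (htd₀ : ∀ φ : (W.baseChange F₀).toAffine.Point →+ ℤ_[p],
    ∃ η₀ : contOneCocycles (restrictedTateRep W F₀ p).toTopRep, ∀ P, B₀ η₀ P = φ P)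
  (htd : ∀ φ : (W.baseChange F).toAffine.Point →+ ℤ_[p],
    ∃ η : contOneCocycles ((restrictedTateRep W F₀ p).restrict (absGaloisRestrict F₀ F)).toTopRep, ∀ P, B η P = φ P)
  (hN₀ : ∀ b : F₀, (∀ P : (W.baseChange F₀).toAffine.Point,
    Algebra.trace ℚ_[p] F₀ (b * FormalGroupChart.padicLogPointFiniteExt w₀ (W.baseChange F₀) p P) = 0) → b = 0)
  (hN : ∀ b : F, (∀ P : (W.baseChange F).toAffine.Point,
    Algebra.trace ℚ_[p] F (b * FormalGroupChart.padicLogPointFiniteExt w (W.baseChange F) p P) = 0) → b = 0)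
  (hadd₀ : ∀ P Q : (W.baseChange F₀).toAffine.Point,
    FormalGroupChart.padicLogPointFiniteExt w₀ (W.baseChange F₀) p (P + Q) =
      FormalGroupChart.padicLogPointFiniteExt w₀ (W.baseChange F₀) p P +
        FormalGroupChart.padicLogPointFiniteExt w₀ (W.baseChange F₀) p Q)
  (hadd : ∀ P Q : (W.baseChange F).toAffine.Point,
    FormalGroupChart.padicLogPointFiniteExt w (W.baseChange F) p (P + Q) =
      FormalGroupChart.padicLogPointFiniteExt w (W.baseChange F) p P +
        FormalGroupChart.padicLogPointFiniteExt w (W.baseChange F) p Q)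

include hc hrec₀ hrec htd₀ htd hN₀ hN hadd₀ hadd in
/-- ★ **(S5b-tower) from the reciprocity laws at the two levels with ONE constant**: with `e = c⁻¹ ∈ F₀ˣ`, BOTH
`range(exp*_{e•d₀}) = (log_ω E(F₀))^∨_{Tr}` and `range(exp*_{e•d}) = (log_ω E(F))^∨_{Tr}` (the scalar at `F` being
`algebraMap F₀ F e`) — the conclusion of `exists_smul_range_expStarCoord_tower_iff_trace_log` VERBATIM.
[cite: Kato1993LNM1553, Ch. II Thm. 1.4.1 (3)–(4) and §1.2.4] [cite: BlochKato1990, Prop. 3.8 (p. 354), Example 3.11 (p. 361)] -/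
theorem exists_smul_range_tower_of_reciprocity :
    ∃ (e : F₀) (he : e ≠ 0),
      (∀ a₀ : F₀,
        (∃ η₀ : contOneCocycles (restrictedTateRep W F₀ p).toTopRep,
            expStarCoord W hp₀ (d₀.smul e he) η₀ = a₀) ↔
          ∀ P : (W.baseChange F₀).toAffine.Point,
            ‖Algebra.trace ℚ_[p] F₀
                (a₀ * FormalGroupChart.padicLogPointFiniteExt w₀ (W.baseChange F₀) p P)‖ ≤ 1) ∧
      (∀ a : F,
        (∃ η : contOneCocycles ((restrictedTateRep W F₀ p).restrict (absGaloisRestrict F₀ F)).toTopRep,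
            expStarCoordTower W hp (d.smul (algebraMap F₀ F e) ((map_ne_zero (algebraMap F₀ F)).mpr he)) η = a) ↔
          ∀ P : (W.baseChange F).toAffine.Point,
            ‖Algebra.trace ℚ_[p] F
                (a * FormalGroupChart.padicLogPointFiniteExt w (W.baseChange F) p P)‖ ≤ 1) := by
  refine ⟨c⁻¹, inv_ne_zero hc, range_expStarCoord_smul_iff_of_reciprocity W hp₀ w₀ d₀ B₀ c hc hrec₀ htd₀ hN₀ hadd₀,
    fun a => ?_⟩
  -- the upper level: the same argument with the constant `algebraMap F₀ F c`
  have hc' : algebraMap F₀ F c ≠ 0 := (map_ne_zero (algebraMap F₀ F)).mpr hc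
  have hsmul : ∀ η, expStarCoordTower W hp (d.smul (algebraMap F₀ F c⁻¹)
      ((map_ne_zero (algebraMap F₀ F)).mpr (inv_ne_zero hc))) η = algebraMap F₀ F c * expStarCoordTower W hp d η :=
    fun η => by rw [expStarCoordTower_smul, map_inv₀, inv_inv]
  constructor
  · rintro ⟨η, rfl⟩ P
    rw [hsmul, ← hrec η P]
    exact PadicInt.norm_le_one _
  · intro ha
    let φ : (W.baseChange F).toAffine.Point →+ ℤ_[p] :=
      { toFun := fun P => ⟨Algebra.trace ℚ_[p] F (a * FormalGroupChart.padicLogPointFiniteExt w (W.baseChange F) p P), ha P⟩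
        map_zero' := by
          apply Subtype.ext
          change Algebra.trace ℚ_[p] F (a * FormalGroupChart.padicLogPointFiniteExt w (W.baseChange F) p 0) = 0
          have h0 : FormalGroupChart.padicLogPointFiniteExt w (W.baseChange F) p 0 = 0 := by
            have h := hadd 0 0
            rw [add_zero] at h
            exact left_eq_add.mp h
          rw [h0, mul_zero, map_zero]
        map_add' := fun P Q => by
          apply Subtype.ext
          change Algebra.trace ℚ_[p] F (a * FormalGroupChart.padicLogPointFiniteExt w (W.baseChange F) p (P + Q)) =
            Algebra.trace ℚ_[p] F (a * FormalGroupChart.padicLogPointFiniteExt w (W.baseChange F) p P) +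
              Algebra.trace ℚ_[p] F (a * FormalGroupChart.padicLogPointFiniteExt w (W.baseChange F) p Q)
          rw [hadd, mul_add, map_add] }
    obtain ⟨η, hη⟩ := htd φ
    refine ⟨η, ?_⟩
    have hb : algebraMap F₀ F c * expStarCoordTower W hp d η - a = 0 := hN _ fun P => by
      rw [sub_mul, map_sub, ← hrec η P, hη P, sub_eq_zero]
      rfl
    rw [hsmul]
    exact sub_eq_zero.mp hb

end Tower

end Literature.NumberTheory.PAdicHodge

end
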